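import Mathlib
import Summits.Ventures.FusionMHD.Models.RwmFRS1Kq07Solution
import Summits.Ventures.FusionMHD.Models.RwmFRS1Kq07Bessel
import Summits.Ventures.FusionMHD.Models.RwmFRS1Energy
import Summits.Ventures.FusionMHD.Models.ResistiveSchemas
import HarnessLib

/-!
# F3.r4 instance «RwmFRS1Kq07» (candidate row «F3.r4-KINKEQ-RWM21»): THE SENTENCES — no-wall instability of the external
# `(2,1)` mode of the `q_a = 7/5 < 2` screw pinch, the ideal-wall window out to `b = 3/2·a`, the critical wall radius
# `b* ∈ (3/2·a, 7/4·a)`, and the certified thin-wall RWM growth rates at `b = 6/5·a` and `13/10·a`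

Assembly file (model-6 g7) of the chain `RwmFRS1Kq07` → `…Axis` → `…AxisData` → `…AxisJets` → `…AxisValues` → `…Chain` →
`…Solution` (the axis-regular marginal solution `ξ₁ = Kq07.xi`, odd, `C¹` through the axis, no zero on `(0, a]`,
`2.8750717 < L_K = aξ₁′/ξ₁(a) < 2.8750718`) and the model-independent `RwmFRS1Kq07Bessel` (`m = 2` wall factors). It COMPOSES,
BY NAME: lit-4's PROVED external-mode test `ScrewPinch.Profile.newcombExternalModes_iff` [Freidberg2014 §11.5.3
(11.117)–(11.118)] and `fluidEnergy_eq_boundary_of_solution` (so `δW_∞`, `δW_b` of (11.148)–(11.149) ARE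
`externalEnergy 2 k 1 Λ ξ₁ = δŴ(L, Λ)·ξ₁(1)²`, `δŴ(L, Λ) = (9L − 51)/4949 + 9Λ/2450`, `Kq07.boundaryForm_eq`); lit-3's wall
factors [(11.96), (11.150)] with `Λ_∞ < 1` (§8), the §9 brackets of `RwmFRS1Kq07Bessel` and the §12 critical wall radius
`Profile.criticalWallRadius`; model-6's `ResistiveWall.IsThinWallRate` [(11.169)]; the admissibility class `RwmFRS1.IsAdmissible`
of row #71 (`C¹` on `(−51/50, 51/50)`, not `≡ 0` on `[0, a]`).

CERTIFIED SENTENCES (MODEL M_RWM,K = row #95's EXACT force-balanced screw pinch `KinkEqQ07.hlK` (`q = (7/10)(1+r²)`,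
`q_a = 7/5`, `β₀ = 151/2450`; `isRadialPressureBalanceK`) + vacuum + thin resistive wall, `R₀ = 5a` DECLARED; wall radii
`b/a ∈ {6/5, 13/10, 3/2, 7/4}` DECLARED SYNTHETIC; CLASS C = external `(m,n) = (2,1)`, `q = 2` in the vacuum at `r² = 13/7`):
1. `lambdaCrit_bounds` — `Λ_crit = 2450(17 − 3L_K)/14847 ∈ (1.38197, 1.38198)`;
2. **`dWinf_neg`**, **`noWall_not_stable`** — `δW_∞ < 0` from lit-3's GENERIC `Λ_∞ < 1 < Λ_crit` (no Bessel value needed):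
   without a wall the `(2,1)` external kink side of M_RWM,K (the printed `q_a < 2` picture, VALIDATED: tokamak band (11.221)
   `1.3235 < nq_a = 1.4 < 2`);
3. **`dWb_pos`** (`b = 3/2·a`: `Λ_b ≥ 1.453 > Λ_crit`), **`idealWall_stable`**, **`idealWall_window`** (every `a < b ≤ 3/2·a`);
   **`dWb_neg`** (`b = 7/4·a`: `Λ_b ≤ 1.244 < Λ_crit`), **`dWb_neg_far`** (every `b ≥ 7/4·a`); hence
   **`criticalWallRadius_bounds`: `3/2·a < b* < 7/4·a`** and **`idealWall_stable_iff`** (`b < b*`);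
4. **`rwm_rate_13`** — thin wall at `b = 13/10·a`: every `γ` with `γτ_w·δW_b = −δW_∞` satisfies **`0.54 < γτ_w < 0.62`**;
   **`rwm_rate_12`** — at `b = 6/5·a`: **`0.256 < γτ_w < 0.283`**; `rwm_grows_of_lt` — `γ > 0` for every thin wall
   `a < b < b*` (`τ_w > 0`).  HONEST WIDTH: `±6 %` on the rates from the leading-order `K_2` enclosure (`RwmFRS1Kq07Bessel`).
VALIDATED (not load-bearing): float `L = 2.875072`, `Λ_∞ = 0.99045`, `Λ_crit = 1.38198`, `b_crit = 1.566a`, `γτ_w = 0.583`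
(13/10), `0.270` (6/5) (work/preview, model-6 g7).  HONESTY: the same model's internal `(1,1)` kink is CERTIFIED UNSTABLE
(★ #95 `KinkEqQ07.kink_sigma_unstable`) — the present sentences concern the external `(2,1)` class only; never
«stable/unstable» without «MODEL M_RWM,K, mode (2,1)»; nothing about a device. [instance data]
-/

noncomputable section

open Set Filter Polynomial Literature.Analysis.ODE Literature.Analysis.FunctionSpaces
  Literature.MathematicalPhysics.MHD Literature.MathematicalPhysics.MHD.ScrewPinch
open scoped Topology

namespace Summit.Ventures.FusionMHD.Models

namespace RwmFRS1

namespace Kq07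

/-! ### The reference energies of the marginal solution are the boundary form (Freidberg (11.148)) -/

/-- **(11.148) FOR `ξ₁`** (MODEL M_RWM,K, `m = 2`): for every wall factor `Λ`,
`externalEnergy 2 k 1 Λ ξ₁ = δŴ(L_K, Λ)·ξ₁(1)²`, `L_K = ξ₁′(1)/ξ₁(1)`. [cite: Freidberg2014, §11.5.6 eq. (11.148)] -/
theorem externalEnergy_xi (Λ : ℝ) :
    PK.externalEnergy 2 kk 1 Λ Kq07.xi = Kq07.boundaryForm (1 * deriv Kq07.xi 1 / Kq07.xi 1) Λ * Kq07.xi 1 ^ 2 := by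
  obtain ⟨hBθ, hBz, hp, hBθ0⟩ := profile_regular (51 / 50)
  have hF : ∀ r ∈ Ioc (0 : ℝ) 1, PK.kDotB 2 kk r ≠ 0 := fun r hr => kDotB_ne_zero hr.1 (by nlinarith [hr.1, hr.2])
  have hODE : ∀ r ∈ Ioo (0 : ℝ) 1,
      HasDerivAt (fun s => PK.newcombF 2 kk s * deriv Kq07.xi s) (PK.newcombG 2 kk r * Kq07.xi r) r :=
    fun r hr => xi_newcomb ⟨hr.1, by linarith [hr.2]⟩
  have hE := Profile.fluidEnergy_eq_boundary_of_solution (P := PK) (m := 2) (k := kk) one_pos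
    (by norm_num : (1 : ℝ) < 51 / 50) (by norm_num) hBθ hBz hp hBθ0 hF xi_contDiffOn hODE
  have hx : Kq07.xi 1 ≠ 0 := xi_ne_zero 1 ⟨one_pos, le_rfl⟩
  unfold Profile.externalEnergy
  rw [hE, Kq07.boundaryForm]
  unfold Profile.newcombF
  field_simp
  ring

/-- The NO-WALL reference energy `δW_∞` of the marginal solution (per `2π²R₀/μ₀`), MODEL M_RWM,K, mode `(2,1)`.
[cite: Freidberg2014, §11.5.6 eq. (11.149)] -/
def dWinf : ℝ := PK.externalEnergy 2 kk 1 (Vacuum.wallFactorInf 2 kk 1) Kq07.xi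

/-- The IDEAL-WALL reference energy `δW_b` of the marginal solution, wall at `r = b`, MODEL M_RWM,K, mode `(2,1)`.
[cite: Freidberg2014, §11.5.6 eq. (11.149)] -/
def dWb (b : ℝ) : ℝ := PK.externalEnergy 2 kk 1 (Vacuum.wallFactor 2 kk 1 b) Kq07.xi

/-- `ξ₁(1)² > 0`. [instance data] -/
theorem xi_one_sq_pos : 0 < Kq07.xi 1 ^ 2 := by
  have := xi_pos one_pos le_rfl
  positivity

/-! ### Sentence 1: the critical wall factor -/

/-- **`Λ_crit ∈ (1.38197, 1.38198)`** (from `2.8750717 < L_K < 2.8750718`). [instance data] -/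
theorem lambdaCrit_bounds : (138197 / 100000 : ℝ) < Kq07.lambdaCrit (1 * deriv Kq07.xi 1 / Kq07.xi 1) ∧
    Kq07.lambdaCrit (1 * deriv Kq07.xi 1 / Kq07.xi 1) < (138198 / 100000 : ℝ) := by
  obtain ⟨h1, h2⟩ := L_bounds
  unfold Kq07.lambdaCrit
  constructor <;> linarith

/-! ### Sentences 2–3: energies of the marginal solution and the external-mode test -/

/-- **SENTENCE 2 (no wall): `δW_∞ < 0`** — `Λ_∞ < 1 < Λ_crit` (lit-3's generic bound; no Bessel value needed).
[cite: Freidberg2014, §11.5.6 eq. (11.149), (11.151)] -/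
theorem dWinf_neg : Kq07.dWinf < 0 := by
  rw [Kq07.dWinf, externalEnergy_xi]
  have hΛ : Vacuum.wallFactorInf 2 kk 1 < 1 :=
    Vacuum.wallFactorInf_lt_one (by norm_num) (by rw [kk]; norm_num) one_pos
  have hneg : Kq07.boundaryForm (1 * deriv Kq07.xi 1 / Kq07.xi 1) (Vacuum.wallFactorInf 2 kk 1) < 0 := by
    rw [boundaryForm_neg_iff]
    linarith [lambdaCrit_bounds.1]
  exact mul_neg_of_neg_of_pos hneg xi_one_sq_pos

/-- **SENTENCE 3 (ideal wall at `b = 3/2·a`): `δW_b > 0`** — `Λ_b ≥ 1.453 > Λ_crit`.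
[cite: Freidberg2014, §11.5.6 eq. (11.149), (11.151)] -/
theorem dWb_pos : 0 < Kq07.dWb (3 / 2) := by
  rw [Kq07.dWb, externalEnergy_xi]
  have hΛ : (1453 / 1000 : ℝ) ≤ Vacuum.wallFactor 2 kk 1 (3 / 2) := by
    rw [wallFactor_two_eq, show (1 / 5 : ℝ) * (3 / 2) = 3 / 10 by norm_num]
    exact lambdaWall_30_bounds.1
  have hpos : 0 < Kq07.boundaryForm (1 * deriv Kq07.xi 1 / Kq07.xi 1) (Vacuum.wallFactor 2 kk 1 (3 / 2)) := by
    rw [boundaryForm_pos_iff]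
    linarith [lambdaCrit_bounds.2]
  exact mul_pos hpos xi_one_sq_pos

/-- **Ideal wall at `b = 7/4·a`: `δW_b < 0`** — `Λ_b ≤ 1.244 < Λ_crit` (wall too far). [cite: Freidberg2014, §11.5.6 eq. (11.149)] -/
theorem dWb_neg : Kq07.dWb (7 / 4) < 0 := by
  rw [Kq07.dWb, externalEnergy_xi]
  have hΛ : Vacuum.wallFactor 2 kk 1 (7 / 4) ≤ (311 / 250 : ℝ) := by
    rw [wallFactor_two_eq, show (1 / 5 : ℝ) * (7 / 4) = 7 / 20 by norm_num]
    exact lambdaWall_35_bounds.2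
  have hneg : Kq07.boundaryForm (1 * deriv Kq07.xi 1 / Kq07.xi 1) (Vacuum.wallFactor 2 kk 1 (7 / 4)) < 0 := by
    rw [boundaryForm_neg_iff]
    linarith [lambdaCrit_bounds.1]
  exact mul_neg_of_neg_of_pos hneg xi_one_sq_pos

/-- The marginal solution `ξ₁` is admissible (row #71's class `RwmFRS1.IsAdmissible`). [instance data] -/
theorem xi_admissible : IsAdmissible Kq07.xi :=
  ⟨xi_contDiffOn, 1, ⟨zero_le_one, le_rfl⟩, xi_ne_zero 1 ⟨one_pos, le_rfl⟩⟩

/-- **NEWCOMB'S EXTERNAL-MODE TEST FOR MODEL M_RWM,K, MODE `(2,1)`** (lit-4's `newcombExternalModes_iff` instantiated with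
the kernel solution `ξ₁`): for every wall factor `Λ`, ALL admissible displacements have positive external energy iff
`δŴ(L_K, Λ)·ξ₁(1)² > 0`. [cite: Freidberg2014, §11.5.3 eq. (11.118)] -/
theorem externalModes_iff (Λ : ℝ) :
    (∀ ξ : ℝ → ℝ, IsAdmissible ξ → 0 < PK.externalEnergy 2 kk 1 Λ ξ) ↔
      0 < Kq07.boundaryForm (1 * deriv Kq07.xi 1 / Kq07.xi 1) Λ * Kq07.xi 1 ^ 2 := by
  obtain ⟨hBθ, hBz, hp, hBθ0⟩ := profile_regular (51 / 50)
  have hF : ∀ r ∈ Ioc (0 : ℝ) 1, PK.kDotB 2 kk r ≠ 0 := fun r hr => kDotB_ne_zero hr.1 (by nlinarith [hr.1, hr.2])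
  have hODE : ∀ r ∈ Ioo (0 : ℝ) 1,
      HasDerivAt (fun s => PK.newcombF 2 kk s * deriv Kq07.xi s) (PK.newcombG 2 kk r * Kq07.xi r) r :=
    fun r hr => xi_newcomb ⟨hr.1, by linarith [hr.2]⟩
  have h := Profile.newcombExternalModes_iff (P := PK) (m := 2) (k := kk) one_pos (by norm_num : (1 : ℝ) < 51 / 50)
    (by norm_num) hBθ hBz hp hBθ0 hF xi_contDiffOn hODE xi_ne_zero Λ
  rw [boundaryForm_mul] at h
  constructor
  · intro hall
    exact h.1 fun ξ hξ hne => hall ξ ⟨hξ, hne⟩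
  · intro hpos ξ hξ
    exact h.2 hpos ξ hξ.1 hξ.2

/-- **SENTENCE 2′ (no wall): NOT every admissible displacement has positive no-wall energy** — `ξ₁` itself has
`δW_∞ < 0` (the external `(2,1)` kink side of MODEL M_RWM,K; never «the device is unstable»).
[cite: Freidberg2014, §11.5.6 eq. (11.151)] -/
theorem noWall_not_stable :
    ¬ (∀ ξ : ℝ → ℝ, IsAdmissible ξ → 0 < PK.externalEnergy 2 kk 1 (Vacuum.wallFactorInf 2 kk 1) ξ) := by
  intro hall
  have h := hall Kq07.xi xi_admissible
  have h2 := dWinf_neg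
  rw [Kq07.dWinf] at h2
  linarith

/-- **SENTENCE 3′ (ideal wall at `b = 3/2·a`): EVERY admissible displacement has positive ideal-wall energy** in MODEL
M_RWM,K, mode `(2,1)` (wall-stabilised side). [cite: Freidberg2014, §11.5.6 eq. (11.151)] -/
theorem idealWall_stable :
    ∀ ξ : ℝ → ℝ, IsAdmissible ξ → 0 < PK.externalEnergy 2 kk 1 (Vacuum.wallFactor 2 kk 1 (3 / 2)) ξ := by
  have h := dWb_pos
  rw [Kq07.dWb, externalEnergy_xi] at h
  exact (externalModes_iff _).2 h

/-- **THE IDEAL-WALL WINDOW**: for every DECLARED wall radius `a < b ≤ 3/2·a` all admissible displacements have positive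
energy in MODEL M_RWM,K, mode `(2,1)` (`Λ_b` is decreasing in `b`, lit-3 `strictAntiOn_wallFactor`).
[cite: Freidberg2014, §11.5.6 eq. (11.150)–(11.151)] -/
theorem idealWall_window {b : ℝ} (hb1 : 1 < b) (hb2 : b ≤ 3 / 2) :
    ∀ ξ : ℝ → ℝ, IsAdmissible ξ → 0 < PK.externalEnergy 2 kk 1 (Vacuum.wallFactor 2 kk 1 b) ξ := by
  have hk : kk ≠ 0 := by rw [kk]; norm_num
  have hmono := Vacuum.strictAntiOn_wallFactor (m := 2) (by norm_num) hk one_pos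
  have hΛ : Vacuum.wallFactor 2 kk 1 (3 / 2) ≤ Vacuum.wallFactor 2 kk 1 b := by
    rcases eq_or_lt_of_le hb2 with h | h
    · rw [h]
    · exact (hmono (show (1 : ℝ) < b from hb1) (show (1 : ℝ) < 3 / 2 by norm_num) h).le
  have h32 := dWb_pos
  rw [Kq07.dWb, externalEnergy_xi] at h32
  refine (externalModes_iff _).2 ?_
  have hx := xi_one_sq_pos
  have hmonoB := (boundaryForm_strictMono (1 * deriv Kq07.xi 1 / Kq07.xi 1)).monotone hΛ
  have : 0 < Kq07.boundaryForm (1 * deriv Kq07.xi 1 / Kq07.xi 1) (Vacuum.wallFactor 2 kk 1 (3 / 2)) :=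
    pos_of_mul_pos_left h32 hx.le
  exact mul_pos (lt_of_lt_of_le this hmonoB) hx

/-- **Far walls do not stabilise**: for every `b ≥ 7/4·a` the marginal solution `ξ₁` has negative ideal-wall energy
(MODEL M_RWM,K, mode `(2,1)`). [cite: Freidberg2014, §11.5.6 eq. (11.150)] -/
theorem dWb_neg_far {b : ℝ} (hb : 7 / 4 ≤ b) : Kq07.dWb b < 0 := by
  have hk : kk ≠ 0 := by rw [kk]; norm_num
  have hmono := Vacuum.strictAntiOn_wallFactor (m := 2) (by norm_num) hk one_pos
  have hΛ : Vacuum.wallFactor 2 kk 1 b ≤ Vacuum.wallFactor 2 kk 1 (7 / 4) := by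
    rcases eq_or_lt_of_le hb with h | h
    · rw [h]
    · exact (hmono (show (1 : ℝ) < 7 / 4 by norm_num) (show (1 : ℝ) < b by linarith) h).le
  have h74 := dWb_neg
  rw [Kq07.dWb, externalEnergy_xi] at h74 ⊢
  have hx := xi_one_sq_pos
  have hmonoB := (boundaryForm_strictMono (1 * deriv Kq07.xi 1 / Kq07.xi 1)).monotone hΛ
  have : Kq07.boundaryForm (1 * deriv Kq07.xi 1 / Kq07.xi 1) (Vacuum.wallFactor 2 kk 1 (7 / 4)) < 0 :=
    neg_of_mul_neg_left (by linarith) hx.le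
  exact mul_neg_of_neg_of_pos (lt_of_le_of_lt hmonoB this) hx

/-! ### The critical wall radius `b*` (lit-3 §12, by name) -/

/-- The hypotheses of lit-3's critical-wall theorems for the `(2,1)` marginal solution of MODEL M_RWM,K: `F_a ≠ 0`, `ξ₁(a) ≠ 0`,
`δW_∞ < 0` (mode number as the natural number `2`). [instance data] -/
theorem criticalWall_hyps : PK.kDotB ((2 : ℕ) : ℝ) kk 1 ≠ 0 ∧ Kq07.xi 1 ≠ 0 ∧
    PK.externalEnergy ((2 : ℕ) : ℝ) kk 1 (Vacuum.wallFactorInf 2 kk 1) Kq07.xi < 0 := by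
  have h1 : PK.kDotB 2 kk 1 ≠ 0 := by rw [edge_values.1]; norm_num
  have h3 := dWinf_neg
  rw [Kq07.dWinf] at h3
  refine ⟨?_, xi_ne_zero 1 ⟨one_pos, le_rfl⟩, ?_⟩
  · simpa only [Nat.cast_ofNat] using h1
  · simpa only [Nat.cast_ofNat] using h3

/-- **`δW_b > 0 ⇔ b < b*`** for every wall `b > a = 1` (MODEL M_RWM,K, mode `(2,1)`).
[cite: Freidberg2014, §11.5.6 eqs. (11.149)–(11.151), p. 491] -/
theorem dWb_pos_iff {b : ℝ} (hb : 1 < b) : 0 < Kq07.dWb b ↔ b < PK.criticalWallRadius 2 kk 1 Kq07.xi := by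
  obtain ⟨hF, hξ, hinf⟩ := criticalWall_hyps
  have hk : kk ≠ 0 := by rw [kk]; norm_num
  have h := PK.externalEnergy_wall_pos_iff (m := 2) (by norm_num) hk one_pos hF hξ hinf hb
  rw [Kq07.dWb]
  simpa only [Nat.cast_ofNat] using h

/-- **`δW_b < 0 ⇔ b* < b`** for every wall `b > a = 1` (MODEL M_RWM,K, mode `(2,1)`).
[cite: Freidberg2014, §11.5.6 eqs. (11.149)–(11.151), p. 491] -/
theorem dWb_neg_iff {b : ℝ} (hb : 1 < b) : Kq07.dWb b < 0 ↔ PK.criticalWallRadius 2 kk 1 Kq07.xi < b := by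
  obtain ⟨hF, hξ, hinf⟩ := criticalWall_hyps
  have hk : kk ≠ 0 := by rw [kk]; norm_num
  have h := PK.externalEnergy_wall_neg_iff (m := 2) (by norm_num) hk one_pos hF hξ hinf hb
  rw [Kq07.dWb]
  simpa only [Nat.cast_ofNat] using h

/-- **`3/2·a < b* < 7/4·a`**: the critical wall radius of the `(2,1)` mode of MODEL M_RWM,K lies strictly between the two
DECLARED wall radii (`δW_b(3/2) > 0`, `δW_b(7/4) < 0`; VALIDATED float `1.566a`). [instance data] -/
theorem criticalWallRadius_bounds : (3 / 2 : ℝ) < PK.criticalWallRadius 2 kk 1 Kq07.xi ∧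
    PK.criticalWallRadius 2 kk 1 Kq07.xi < (7 / 4 : ℝ) :=
  ⟨(dWb_pos_iff (by norm_num)).1 dWb_pos, (dWb_neg_iff (by norm_num)).1 dWb_neg⟩

/-- **IDEAL-WALL STABILITY ⇔ WALL INSIDE THE CRITICAL RADIUS**: for every wall `b > a = 1`, ALL admissible displacements
have positive ideal-wall energy in MODEL M_RWM,K, mode `(2,1)`, iff `b < b*`.
[cite: Freidberg2014, §11.5.3 eq. (11.118); §11.5.6 p. 491] -/
theorem idealWall_stable_iff {b : ℝ} (hb : 1 < b) :
    (∀ ξ : ℝ → ℝ, IsAdmissible ξ → 0 < PK.externalEnergy 2 kk 1 (Vacuum.wallFactor 2 kk 1 b) ξ) ↔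
      b < PK.criticalWallRadius 2 kk 1 Kq07.xi := by
  rw [externalModes_iff, ← externalEnergy_xi, ← dWb_pos_iff hb, Kq07.dWb]

/-! ### Sentence 4: the thin-wall resistive wall mode (Freidberg (11.169)) -/

/-- **THE RWM GROWS FOR EVERY THIN WALL INSIDE THE CRITICAL RADIUS** (`1 < b < b*`, MODEL M_RWM,K, mode `(2,1)`): every `γ`
of the printed relation `γτ_w·δW_b = −δW_∞` with `τ_w > 0` is positive. [cite: Freidberg2014, §11.5.6 eq. (11.169), p. 492] -/
theorem rwm_grows_of_lt {b γ τw : ℝ} (hb : 1 < b) (hlt : b < PK.criticalWallRadius 2 kk 1 Kq07.xi) (hτ : 0 < τw)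
    (h : ResistiveWall.IsThinWallRate Kq07.dWinf (Kq07.dWb b) τw γ) : 0 < γ :=
  h.growth_pos hτ dWinf_neg ((dWb_pos_iff hb).2 hlt)

/-- The rate identity: at a wall `b` with bracket `Λ_b ∈ [lo, up]`, `lo > Λ_crit`, every thin-wall rate satisfies
`(Λ_c⁻ − Λ_∞⁺)/(up − Λ_c⁻) < γτ_w < (Λ_c⁺ − Λ_∞⁻)/(lo − Λ_c⁺)` — here packaged as the linear facts used twice below.
[cite: Freidberg2014, §11.5.6 eq. (11.169)] -/
theorem rate_key {γ τw b : ℝ} (h : ResistiveWall.IsThinWallRate Kq07.dWinf (Kq07.dWb b) τw γ) :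
    γ * τw * (Vacuum.lambdaWall 2 (1 / 5) (1 / 5 * b) - Kq07.lambdaCrit (1 * deriv Kq07.xi 1 / Kq07.xi 1)) =
      Kq07.lambdaCrit (1 * deriv Kq07.xi 1 / Kq07.xi 1) - Vacuum.lambdaInf 2 (1 / 5) := by
  unfold ResistiveWall.IsThinWallRate at h
  rw [Kq07.dWinf, Kq07.dWb, externalEnergy_xi, externalEnergy_xi, wallFactorInf_two_eq, wallFactor_two_eq,
    boundaryForm_eq_sub, boundaryForm_eq_sub] at h
  have hX0 : Kq07.xi 1 ^ 2 ≠ 0 := xi_one_sq_pos.ne'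
  set Lc := Kq07.lambdaCrit (1 * deriv Kq07.xi 1 / Kq07.xi 1)
  set Li := Vacuum.lambdaInf 2 (1 / 5)
  set Lb := Vacuum.lambdaWall 2 (1 / 5) (1 / 5 * b)
  set X := Kq07.xi 1 ^ 2
  have h' : γ * τw * (9 * (Lb - Lc) / 2450 * X) = -(9 * (Li - Lc) / 2450 * X) := h
  field_simp at h'
  linarith

/-- **SENTENCE 4: THE CERTIFIED RWM RATE AT `b = 13/10·a`: `0.54 < γτ_w < 0.62`** (`γτ_w = (Λ_crit − Λ_∞)/(Λ_b − Λ_crit)`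
with `Λ_∞ ∈ [0.99, 0.9909]`, `Λ_b(13/50) ∈ [2.018, 2.099]`, `Λ_crit ∈ (1.38197, 1.38198)`; VALIDATED float `0.583`; honest
`±6 %` width from the `K_2` enclosure). [cite: Freidberg2014, §11.5.6 eq. (11.169)] -/
theorem rwm_rate_13 {γ τw : ℝ} (h : ResistiveWall.IsThinWallRate Kq07.dWinf (Kq07.dWb (13 / 10)) τw γ) :
    (27 / 50 : ℝ) < γ * τw ∧ γ * τw < (31 / 50 : ℝ) := by
  have key := rate_key h
  rw [show (1 / 5 : ℝ) * (13 / 10) = 13 / 50 by norm_num] at key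
  obtain ⟨hc1, hc2⟩ := lambdaCrit_bounds
  obtain ⟨hi1, hi2⟩ := lambdaInf_two_bounds
  obtain ⟨hb1, hb2⟩ := lambdaWall_26_bounds
  set Lc := Kq07.lambdaCrit (1 * deriv Kq07.xi 1 / Kq07.xi 1)
  set Li := Vacuum.lambdaInf 2 (1 / 5)
  set Lb := Vacuum.lambdaWall 2 (1 / 5) (13 / 50)
  have hd : 0 < Lb - Lc := by linarith
  constructor
  · by_contra hle
    rw [not_lt] at hle
    have : γ * τw * (Lb - Lc) ≤ 27 / 50 * (Lb - Lc) := mul_le_mul_of_nonneg_right hle hd.le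
    nlinarith
  · by_contra hle
    rw [not_lt] at hle
    have : 31 / 50 * (Lb - Lc) ≤ γ * τw * (Lb - Lc) := mul_le_mul_of_nonneg_right hle hd.le
    nlinarith

/-- **THE CERTIFIED RWM RATE AT `b = 6/5·a`: `0.256 < γτ_w < 0.283`** (`Λ_b(6/25) ∈ [2.771, 2.906]`; VALIDATED float `0.270`).
[cite: Freidberg2014, §11.5.6 eq. (11.169)] -/
theorem rwm_rate_12 {γ τw : ℝ} (h : ResistiveWall.IsThinWallRate Kq07.dWinf (Kq07.dWb (6 / 5)) τw γ) :
    (32 / 125 : ℝ) < γ * τw ∧ γ * τw < (283 / 1000 : ℝ) := by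
  have key := rate_key h
  rw [show (1 / 5 : ℝ) * (6 / 5) = 6 / 25 by norm_num] at key
  obtain ⟨hc1, hc2⟩ := lambdaCrit_bounds
  obtain ⟨hi1, hi2⟩ := lambdaInf_two_bounds
  obtain ⟨hb1, hb2⟩ := lambdaWall_24_bounds
  set Lc := Kq07.lambdaCrit (1 * deriv Kq07.xi 1 / Kq07.xi 1)
  set Li := Vacuum.lambdaInf 2 (1 / 5)
  set Lb := Vacuum.lambdaWall 2 (1 / 5) (6 / 25)
  have hd : 0 < Lb - Lc := by linarith
  constructor
  · by_contra hle
    rw [not_lt] at hle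
    have : γ * τw * (Lb - Lc) ≤ 32 / 125 * (Lb - Lc) := mul_le_mul_of_nonneg_right hle hd.le
    nlinarith
  · by_contra hle
    rw [not_lt] at hle
    have : 283 / 1000 * (Lb - Lc) ≤ γ * τw * (Lb - Lc) := mul_le_mul_of_nonneg_right hle hd.le
    nlinarith

/-- **The RWM grows at both DECLARED thin walls `b = 6/5·a`, `13/10·a`** (both inside `b*`), `τ_w > 0`.
[cite: Freidberg2014, §11.5.6 eq. (11.169)] -/
theorem rwm_grows {γ τw : ℝ} (hτ : 0 < τw) (h : ResistiveWall.IsThinWallRate Kq07.dWinf (Kq07.dWb (13 / 10)) τw γ) :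
    0 < γ :=
  rwm_grows_of_lt (by norm_num) (by linarith [criticalWallRadius_bounds.1]) hτ h

/-! ### The typed margin schemas of `ResistiveSchemas.lean` instantiated (model-6's «margin m for E against class C») -/

/-- The RWM data of MODEL M_RWM,K for CLASS C = {`(2,1)`} with the wall at `r = b`: the two printed reference energies of
the marginal solution. [instance data] -/
def rwmData (b : ℝ) : ResistiveSchemas.RWMData (ℕ × ℕ) := ⟨{(2, 1)}, fun _ => Kq07.dWinf, fun _ => Kq07.dWb b⟩

/-- **NO-WALL SCHEMA: the printed criterion `δW_∞ > 0` FAILS** on CLASS C = {`(2,1)`} of MODEL M_RWM,K (every wall `b`).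
[cite: Freidberg2014, §11.5.6 eq. (11.151)] -/
theorem noWallSchema_not_criterionHolds (b : ℝ) :
    ¬ (ResistiveSchemas.rwmNoWallSchema (ℕ × ℕ)).CriterionHolds (Kq07.rwmData b) := by
  intro h
  have h21 := h (2, 1) (by simp [ResistiveSchemas.rwmNoWallSchema, Kq07.rwmData])
  simp only [ResistiveSchemas.rwmNoWallSchema, Kq07.rwmData] at h21
  linarith [dWinf_neg]

/-- **IDEAL-WALL SCHEMA: the criterion `δW_b > 0` HOLDS WITH A POSITIVE MARGIN at `b = 3/2·a`** (margin `m = δW_b(3/2) > 0`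
itself) on CLASS C = {`(2,1)`} of MODEL M_RWM,K. [cite: Freidberg2014, §11.5.6 eq. (11.151)] -/
theorem idealWallSchema_hasPositiveMargin :
    (ResistiveSchemas.rwmIdealWallSchema (ℕ × ℕ)).HasPositiveMargin (Kq07.rwmData (3 / 2)) := by
  refine ⟨Kq07.dWb (3 / 2), dWb_pos, fun i hi => ?_⟩
  simp [ResistiveSchemas.rwmIdealWallSchema, Kq07.rwmData]

/-- **IDEAL-WALL SCHEMA ⇔ WALL INSIDE `b*`**: for every wall `b > a`, the printed ideal-wall criterion holds on CLASS C of MODEL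
M_RWM,K iff `b < b*`. [cite: Freidberg2014, §11.5.6 p. 491] -/
theorem idealWallSchema_criterionHolds_iff {b : ℝ} (hb : 1 < b) :
    (ResistiveSchemas.rwmIdealWallSchema (ℕ × ℕ)).CriterionHolds (Kq07.rwmData b) ↔
      b < PK.criticalWallRadius 2 kk 1 Kq07.xi := by
  rw [← dWb_pos_iff hb]
  constructor
  · intro h
    have h21 := h (2, 1) (by simp [ResistiveSchemas.rwmIdealWallSchema, Kq07.rwmData])
    simpa [ResistiveSchemas.rwmIdealWallSchema, Kq07.rwmData] using h21
  · intro h i hi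
    simpa [ResistiveSchemas.rwmIdealWallSchema, Kq07.rwmData] using h

end Kq07

end RwmFRS1

end Summit.Ventures.FusionMHD.Models

end
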